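/-
COR-CM (cell pub-hodgecm2, stage 2 of the Hodge ladder) — Δ2 BRIDGE, (c)+(d) CLOSURE AT ι₁ (COORDINATOR RULING ≈23:30Z, WORLD = C, item (4)):
THE SOCKET REDUCED TO ITS ONE MISSING FIELD.  Seat prover-pub-hodgecm2-rekey-l0-pin-a-g0-0 (re-pointed re-key prover), 2026-08-23.
New file, OUTSIDE the frozen port manifest.  One definition (a structure VALUE assembled from landed∕filed terms) + one theorem; explicit
per-declaration binders; no instance, no named fact, no `sorry`.  FRAMING: HC_CM is NOT proved; «Δ2 BRIDGE CLOSED» is NOT claimed; the (d)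
field `pieces` is NOT inhabited here — it is DISPLAYED, once, as the hypothesis `hPieces` at prove-5's by-value (c) record.
-/
import Summits.HodgeConjecture.CorCM.D2Bridge.JRecordSocketByValue
import Summits.HodgeConjecture.CorCM.D2Bridge.SocketCD

set_option autoImplicit false

/-!
# Δ2 bridge, (c)+(d) socket at the ι₁ pin: `SocketCD` from ONE hypothesis — the `pieces` family at the BY-VALUE J record

[Liu2021] Y. Liu, *Fourier–Jacobi cycles and arithmetic relative trace formula*, Camb. J. Math. **9** (2021) = arXiv:2102.11518.

The END's (c)+(d) socket ✔ `SocketCD F h6 V a₀ h Φ` (`CorCM/D2Bridge/SocketCD.lean`, = `PortJoin/ClosedPrinted.lean` §A :161–:190) has five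
fields.  prove-5's `JRecordSocketByValue.lean` (p373172) inhabits FOUR of them BY VALUE at the socket's literal types — `socketM` (the rational
(4.3) record, [Liu2021] proof of Thm. 4.18, l. 2247–2253 ∕ Rem. 4.17), `socketJH` (= the identity into the tower), `socketJH_injective`,
`socketJH_comm` — from ONE extra printed input `h21` = [Shimura1998, Thm. 21.4] (already displayed by the END's §B).  The FIFTH field `pieces`
(the Albanese-on-pieces package `HcmPieces` below `Level.capThree C.S.K₀`, keyed through `(𝔇).cmClasses K i` — the orientation-sensitive one)
is the cell's open (d) obligation at the ι₁ pin (tree: ✔ `nonempty_hcmPieces_atUniformRest` wants the J interface at the instance `algebraMap = ι₁`;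
✔ `nonempty_hcmPieces_atUniformRest_conjInst` takes it at `ῑ₁` but wants `IsReflexOfTypeG ῑ₁ Φ_μ → adm i d`, refuted at the literal key by
✔ `OrientationReflexConj.not_forall_isReflexOfTypeG_starRingEnd_comp_imp`).

THIS FILE makes that residual ONE NAMED TYPE:

* `socketCDOfPieces … h21 hPieces : SocketCD F h6 V a₀ h Φ` — the socket VALUE whose (c) fields are prove-5's terms and whose `pieces` field
  is the hypothesis `hPieces`, stated at EXACTLY the socket's `pieces` type with `M ↦ socketM …`, `jH ↦ socketJH …` substituted;
* `nonempty_socketCD_of_pieces` — the same as a `Prop` (for END theorems, which are propositions: `obtain ⟨S⟩`).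

So an END fed through the socket plug (socket-1's `SocketCDPlug.thm418C_indexOfRecord_of_socket`, p373086) displays, in place of the five
(c)(d) binders `M ∕ jH ∕ hjHinj ∕ hjH ∕ pieces`, the ONE binder `hPieces` (+ `h21`, already displayed) — the minimal honest residual under WORLD C,
and the exact statement the (d) seats must inhabit.  Nothing about Liu's objects is asserted.  HC_CM is NOT proved; «Δ2 BRIDGE CLOSED» is NOT claimed.

## References
* [Liu2021] Thm. 4.18 (FJcycle.tex l. 2232–2245) and its proof, map (4.2)∕(4.3) (l. 2247–2253); Rem. 4.17 (l. 2226–2228); Thm. 4.18 (1) (l. 2239);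
  Lem. 2.4 (1) (l. 1210–1228); Def. 4.5 (2) (l. 1944–1951); Prop. 4.6 (1) (l. 1969).
* [Shimura1998] G. Shimura, *Abelian Varieties with Complex Multiplication and Modular Functions*, §21.4 Thm. 21.4.
* Tree∕gate: `CorCM/D2Bridge/SocketCD.lean` (✔ p372458), `CorCM/D2Bridge/JRecordSocketByValue.lean` (p373172), `CorCM/D2Bridge/SocketCDPlug.lean` (p373086),
  `CorCM/D2Bridge/HcmPiecesAtPin.lean`, `CorCM/D2Bridge/HcmPiecesAtPinConjInst.lean`.
-/

noncomputable section

open scoped TensorProduct Matrix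

namespace Summit.HodgeConjecture.CorCM.D2Bridge


open NumberField NumberField.InfinitePlace
open HodgeCM.Model HodgeCM.Model.LiuIndex HodgeCM.Model.TowerCarrier
open HodgeCM.Literature.Theta.LiuAlbaneseModuleDatum.D2Bridge (HcmPieces)
open Summit.HodgeConjecture.CorCM.Model
open Literature.AlgebraicGeometry.Motives (CMType)
open Literature.AlgebraicGeometry.HodgeTheory Literature.NumberTheory.Automorphic.PicardCM
open Literature.AlgebraicGeometry.ShimuraVarieties.UnitaryCanonicalModel
open Literature.NumberTheory.ComplexMultiplication
open Literature.NumberTheory.Automorphic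
open Literature.NumberTheory.Automorphic.Liu2021 Literature.NumberTheory.Automorphic.Liu2021.AppendixC
open Literature.NumberTheory.Automorphic.Liu2021.AppendixC.RestOne
open Literature.NumberTheory.Automorphic.Liu2021.Def411WeilCarriers (lineOf locF Rep)
open Summit.HodgeConjecture.CorCM.Transposition.OmegaTransport (realUnit)
open HodgeCM.Model.ArchSideTerm (e₁)
open Literature.NumberTheory.GelbartRogawski1991 Literature.NumberTheory.GelbartRogawski1991.UnitaryDualPair
open Literature.NumberTheory.GelbartRogawski1991.UnitaryDualPair.LocalSplitting (localMu norm_localMu continuous_localMu localMu_toLocalRing_eq_one_iff)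
open Literature.RepresentationTheory Literature.RepresentationTheory.Liu2021
open Summit.HodgeConjecture.CorCM.Transposition

/-! ### Notation (local, no declarations): the pinned dictionary of record, the App-C datum, the tail of the rest of record -/

set_option quotPrecheck false

/-- the PINNED DICTIONARY OF RECORD at `(V, ι₁, a₀)` over the five `_holds` rows (the `h418` binder's dictionary, ✔ `PortJoin/Closed.lean`). -/
local notation "𝔇⟦" V "," ι₁ "," a₀ "⟧" =>
  liuDictionaryPin exists_isReal_hodgeModel_holds hodgePQ_independent_of_hodgeModel_holds BallQuotient.ballQuotientUniformised_holds
    (cmAbelianVarietyRealised_of_eigenbasis exists_isReal_hodgeModel_holds hodgePQ_independent_of_hodgeModel_holds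
      cmAbelianVarietyEigenbasisRealised_holds)
    Literature.NumberTheory.Transcendental.arapura2012_cor_15_4_6_holds V (I V (repAt a₀) (muLiu ι₁ GramClass.rep))
    (line V (repAt a₀) (muLiu ι₁ GramClass.rep))

/-- the App-C standing datum of record `sec42DataOf h isoOf F ι₁ V Φ` ([Liu21, §4.2 ∕ App. C]) at the ported codes. -/
local notation "ℭ⟦" h "," F "," ι₁ "," V "," Φ "⟧" =>
  sec42DataOf h isoOf ⟨HodgeCM.CMField.K F⟩ ι₁
    ⟨HodgeCM.HermSpace3.Hm V, HodgeCM.HermSpace3.isHermitian V, HodgeCM.HermSpace3.signature_ι₁ V, HodgeCM.HermSpace3.posDef_of_ne V⟩ Φ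

/-- the TAIL OF THE REST OF RECORD at `μ` ([Liu21, Def. 4.5 (2), Def. 4.16, Rem. 4.17]: the chosen `D_μ ∈ 𝒜(μ)` with its `(λ_μ, r_μ)` of
Def. 4.5, `Ω(μ)` with the Hecke translates' action): `restTailOne id ι₁ hμ hw (ofPolDR μ (PolDR ι₁ hμ (RMuForm ι₁ hμ))) (𝒯.rhoΩOne …)`. -/
local notation "𝔱⟦" h "," h6 "," F "," ι₁ "," V "," Φ "," μ "," hμ "," hw "⟧" =>
  restTailOne (AlgHom.id ℚ _) ι₁ hμ hw (Def45.Carriers.ofPolDR μ (Def45.PolDR ι₁ hμ (Def45.RMuForm ι₁ hμ)))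
    ((heckeTranslatesFamilyOf heckeTranslate_definedOver_holds h isoOf ⟨HodgeCM.CMField.K F⟩ ι₁
      ⟨HodgeCM.HermSpace3.Hm V, HodgeCM.HermSpace3.isHermitian V, HodgeCM.HermSpace3.signature_ι₁ V, HodgeCM.HermSpace3.posDef_of_ne V⟩ Φ
      h6).rhoΩOne (AlgHom.id ℚ _) ι₁ hμ hw (Def45.Carriers.ofPolDR μ (Def45.PolDR ι₁ hμ (Def45.RMuForm ι₁ hμ))))

/-- the INDEX OF RECORD `LiuIndex.I V (repAt a₀) (muLiu ι₁ rep)` and its lines (port layer 69; the `h418` binder's enumeration). -/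
local notation "𝕀⟦" V "," ι₁ "," a₀ "⟧" => I V (repAt a₀) (muLiu ι₁ GramClass.rep)
local notation "𝕃⟦" V "," ι₁ "," a₀ "⟧" => line V (repAt a₀) (muLiu ι₁ GramClass.rep)

/-- the representative section of record at the index line `i` (re-points Def. 4.12's collection at the package's line `⟨u_{a_i}⟩`). -/
local notation "𝕣⟦" F "," a₀ "," i "⟧" =>
  Rep.update ↥(maximalRealSubfield (HodgeCM.CMField.K F)) (imagUnitSq (HodgeCM.CMField.K F))
    (Rep.ofLineOf ↥(maximalRealSubfield (HodgeCM.CMField.K F)) (imagUnitSq (HodgeCM.CMField.K F)))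
    (locF ↥(maximalRealSubfield (HodgeCM.CMField.K F)) (imagUnitSq (HodgeCM.CMField.K F))
      (realUnit ⟨HodgeCM.CMField.K F⟩ (repAt a₀ (Sigma.fst i)).1 (repAt a₀ (Sigma.fst i)).2.1 (repAt a₀ (Sigma.fst i)).2.2))
    (realUnit ⟨HodgeCM.CMField.K F⟩ (repAt a₀ (Sigma.fst i)).1 (repAt a₀ (Sigma.fst i)).2.1 (repAt a₀ (Sigma.fst i)).2.2) rfl

/-- the μ-UNIFORM WEIL CARRIERS OF RECORD at the index line `i` (own-htheta ✔ `Model.uniformOmegaRep` at `δ′ = (2δ_F)⁻¹`, section 𝕣). -/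
local notation "𝕌⟦" h "," F "," ι₁ "," V "," Φ "," a₀ "," i "⟧" =>
  uniformOmegaRep h ⟨HodgeCM.CMField.K F⟩ ι₁
    ⟨HodgeCM.HermSpace3.Hm V, HodgeCM.HermSpace3.isHermitian V, HodgeCM.HermSpace3.signature_ι₁ V, HodgeCM.HermSpace3.posDef_of_ne V⟩ Φ
    e₁ (frameD V) (frameD_real V) (frameD_ne V) (ιVE V) (2 * imagUnit (HodgeCM.CMField.K F))⁻¹ (fun _ _ => 𝕣⟦F, a₀, i⟧)



/-! ## §1 The socket from the one missing field -/

set_option synthInstance.maxHeartbeats 400000 in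
set_option maxHeartbeats 3200000 in
/-- **THE (c)+(d) SOCKET FROM ITS ONE MISSING FIELD.**  Given the `pieces` family `hPieces` — the Albanese-on-pieces package `HcmPieces` below
`Level.capThree C.S.K₀` at prove-5's BY-VALUE J record (`socketM`, `socketJH`) and the pinned dictionary's `cmClasses K i` — the socket
`SocketCD F h6 V a₀ h Φ` is INHABITED: (c) := prove-5's four terms ([Liu2021] (4.3) ∕ Rem. 4.17 at the rest of record, from `h21` =
[Shimura1998] Thm. 21.4), (d) := `hPieces`.  Pure packaging.  HC_CM is NOT proved.
[cite: Liu2021, proof of Thm. 4.18 (FJcycle.tex l. 2247–2253); Rem. 4.17 (l. 2226–2228); Thm. 4.18 (1) (l. 2239)] [cite: Shimura1998, §21.4 Thm. 21.4] -/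
def socketCDOfPieces (F : HodgeCM.CMField) [IsGalois ℚ (F : Type)] (h6 : 6 ≤ Module.finrank ℚ (F : Type))
    {ι₁ : (F : Type) →+* ℂ} (V : HodgeCM.HermSpace3 F ι₁) (a₀ : RealScalar F) (h : exists_recordSystem) (Φ : CMType (F : Type))
    (h21 : shimura1998_thm21_4_casselman)
    (hPieces : ∀ (i : 𝕀⟦V, ι₁, a₀⟧) (μ : Literature.NumberTheory.Automorphic.IdeleClassGroup (F : Type) →ₜ* Circle)
    (hμ : IdeleClassGroup.IsConjugateSymplectic (F : Type) μ) (hw : IdeleClassGroup.HasWeight (F : Type) μ 1) (hΦμ : IdeleClassGroup.HasCMType (F : Type) μ (𝕃⟦V, ι₁, a₀⟧ i).lineType) (K : HodgeCM.Level V),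
    K ≤ HodgeCM.Level.capThree (V := V) ((ℭ⟦h, F, ι₁, V, Φ⟧).S.K₀.1 : Subgroup ↥V.adelicFin) (ℭ⟦h, F, ι₁, V, Φ⟧).S.K₀.2.1 →
    HcmPieces.{0, 1, 0} (toThm418Data _ ((𝕌⟦h, F, ι₁, V, Φ, a₀, i⟧).rest 𝔱⟦h, h6, F, ι₁, V, Φ, μ, hμ, hw⟧)) (socketM F h6 V a₀ h Φ h21 i μ hμ hw) (𝔇⟦V, ι₁, a₀⟧).H (socketJH F h6 V a₀ h Φ h21 i μ hμ hw) K.K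
      ((HodgeCM.Model.picardCMUniverse exists_isReal_hodgeModel_holds hodgePQ_independent_of_hodgeModel_holds
          BallQuotient.ballQuotientUniformised_holds
          (cmAbelianVarietyRealised_of_eigenbasis exists_isReal_hodgeModel_holds hodgePQ_independent_of_hodgeModel_holds
            cmAbelianVarietyEigenbasisRealised_holds)).CohC
        ((HodgeCM.Model.picardCMUniverse exists_isReal_hodgeModel_holds hodgePQ_independent_of_hodgeModel_holds
          BallQuotient.ballQuotientUniformised_holds
          (cmAbelianVarietyRealised_of_eigenbasis exists_isReal_hodgeModel_holds hodgePQ_independent_of_hodgeModel_holds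
            cmAbelianVarietyEigenbasisRealised_holds)).pms F ι₁ V K) 1)
      (resTotal exists_isReal_hodgeModel_holds hodgePQ_independent_of_hodgeModel_holds
        (ballQuotientUniformisedDatum_of BallQuotient.ballQuotientUniformised_holds)
        (cmAbelianVarietyRealised_of_eigenbasis exists_isReal_hodgeModel_holds hodgePQ_independent_of_hodgeModel_holds
          cmAbelianVarietyEigenbasisRealised_holds)
        Literature.NumberTheory.Transcendental.arapura2012_cor_15_4_6_holds K)
      ((𝔇⟦V, ι₁, a₀⟧).cmClasses K i)) :
    SocketCD F h6 V a₀ h Φ where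
  M i μ hμ hw _ := socketM F h6 V a₀ h Φ h21 i μ hμ hw
  jH i μ hμ hw _ := socketJH F h6 V a₀ h Φ h21 i μ hμ hw
  hjHinj i μ hμ hw _ := socketJH_injective F h6 V a₀ h Φ h21 i μ hμ hw
  hjH i μ hμ hw _ g x := socketJH_comm F h6 V a₀ h Φ h21 i μ hμ hw g x
  pieces i μ hμ hw hΦμ K hK := hPieces i μ hμ hw hΦμ K hK

set_option synthInstance.maxHeartbeats 400000 in
set_option maxHeartbeats 3200000 in
/-- **… as a proposition**: under `hPieces` the (c)+(d) socket is NON-EMPTY (the form an END theorem consumes: `obtain ⟨S⟩ := …`). HC_CM is NOT proved.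
[cite: Liu2021, proof of Thm. 4.18 (FJcycle.tex l. 2247–2253); Rem. 4.17 (l. 2226–2228)] [cite: Shimura1998, §21.4 Thm. 21.4] -/
theorem nonempty_socketCD_of_pieces (F : HodgeCM.CMField) [IsGalois ℚ (F : Type)] (h6 : 6 ≤ Module.finrank ℚ (F : Type))
    {ι₁ : (F : Type) →+* ℂ} (V : HodgeCM.HermSpace3 F ι₁) (a₀ : RealScalar F) (h : exists_recordSystem) (Φ : CMType (F : Type))
    (h21 : shimura1998_thm21_4_casselman)
    (hPieces : ∀ (i : 𝕀⟦V, ι₁, a₀⟧) (μ : Literature.NumberTheory.Automorphic.IdeleClassGroup (F : Type) →ₜ* Circle)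
    (hμ : IdeleClassGroup.IsConjugateSymplectic (F : Type) μ) (hw : IdeleClassGroup.HasWeight (F : Type) μ 1) (hΦμ : IdeleClassGroup.HasCMType (F : Type) μ (𝕃⟦V, ι₁, a₀⟧ i).lineType) (K : HodgeCM.Level V),
    K ≤ HodgeCM.Level.capThree (V := V) ((ℭ⟦h, F, ι₁, V, Φ⟧).S.K₀.1 : Subgroup ↥V.adelicFin) (ℭ⟦h, F, ι₁, V, Φ⟧).S.K₀.2.1 →
    HcmPieces.{0, 1, 0} (toThm418Data _ ((𝕌⟦h, F, ι₁, V, Φ, a₀, i⟧).rest 𝔱⟦h, h6, F, ι₁, V, Φ, μ, hμ, hw⟧)) (socketM F h6 V a₀ h Φ h21 i μ hμ hw) (𝔇⟦V, ι₁, a₀⟧).H (socketJH F h6 V a₀ h Φ h21 i μ hμ hw) K.K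
      ((HodgeCM.Model.picardCMUniverse exists_isReal_hodgeModel_holds hodgePQ_independent_of_hodgeModel_holds
          BallQuotient.ballQuotientUniformised_holds
          (cmAbelianVarietyRealised_of_eigenbasis exists_isReal_hodgeModel_holds hodgePQ_independent_of_hodgeModel_holds
            cmAbelianVarietyEigenbasisRealised_holds)).CohC
        ((HodgeCM.Model.picardCMUniverse exists_isReal_hodgeModel_holds hodgePQ_independent_of_hodgeModel_holds
          BallQuotient.ballQuotientUniformised_holds
          (cmAbelianVarietyRealised_of_eigenbasis exists_isReal_hodgeModel_holds hodgePQ_independent_of_hodgeModel_holds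
            cmAbelianVarietyEigenbasisRealised_holds)).pms F ι₁ V K) 1)
      (resTotal exists_isReal_hodgeModel_holds hodgePQ_independent_of_hodgeModel_holds
        (ballQuotientUniformisedDatum_of BallQuotient.ballQuotientUniformised_holds)
        (cmAbelianVarietyRealised_of_eigenbasis exists_isReal_hodgeModel_holds hodgePQ_independent_of_hodgeModel_holds
          cmAbelianVarietyEigenbasisRealised_holds)
        Literature.NumberTheory.Transcendental.arapura2012_cor_15_4_6_holds K)
      ((𝔇⟦V, ι₁, a₀⟧).cmClasses K i)) :
    Nonempty (SocketCD F h6 V a₀ h Φ) :=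
  ⟨socketCDOfPieces F h6 V a₀ h Φ h21 hPieces⟩

end Summit.HodgeConjecture.CorCM.D2Bridge

end
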